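import Literature.NumberTheory.DiophantineGeometry.BcgpSwitchExistsModularAbelianSurface
import Literature.NumberTheory.GaloisRepresentations.CrystallineOrdinaryShape
import HarnessLib

/-!
# BCGP 2025, Lemma 10.4.1: residual modularity for `GSp₄` ⟹ modularity of abelian surfaces

Topic `NumberTheory/DiophantineGeometry` (next to `bcgp_switch_exists_modular_abelianSurface`). One
named fact — a published IMPLICATION whose two sides are written inline; the hypothesis is not
asserted. No `sorry`, no new mathematical object. Since the verdict clean-up of 2026-08-17 (last
section of this docstring) the declaration `bcgp_serreRegularWeight_implies_allAbelianSurfacesModular`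
(similitude of the automorphic lift left free, `∃ μ`) is a `@[deprecated]` RECORD, no longer a named
fact of the literature: it is MISSTATED — stronger than the source — and kept verbatim only because
one `Summits` module still applies it. The CORRECTED statement (similitude FIXED) is the conclusion
type of the theorem `bcgp_serreRegularWeightFixedSimilitude_implies_allAbelianSurfacesModular_of_serreRegularWeight`
of this file; its name as a fact, `bcgp_serreRegularWeightFixedSimilitude_implies_allAbelianSurfacesModular`,
is reserved for the definition proposal described in that section.

Source: G. Boxer, F. Calegari, T. Gee, V. Pilloni, *Modularity theorems for abelian surfaces*,
arXiv:2502.20645, §10.4, **Lemma 10.4.1** ("Serre's Conjecture in regular weight implies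
modularity"), **Remark 10.4.2** (variant: the hypothesis only for `p` sufficiently large) and §10.2,
**Theorem 10.2.1** (abelian surfaces of the 32 Galois types other than **A** and **B**[C₂] are
modular), with the notion of modularity of **Definition 1.8.12** and the transfer `GSp₄ ↔ GL₄` of
§1.8.10 (Arthur's classification; Gee–Taïbi).

PRINTED STATEMENT (Lemma 10.4.1). *Suppose that for every residual representation `ρ̄ : G_ℚ →
GSp₄(𝔽_p)` with multiplier `ε̄⁻¹`, absolutely irreducible, and such that the semisimplification of
`ρ̄|_{G_{ℚ_p}}` is a direct sum of characters, there exists an ordinary cuspidal automorphic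
representation `π` of `GSp₄/ℚ` of regular weight, level prime to `p` and central character `|·|²`
with `ρ̄_{π,p} ≅ ρ̄`. Then all abelian surfaces `A/ℚ` are modular.* Remark 10.4.2: "one could only
demand the statement for `p` sufficiently large". Modular (Def. 1.8.12): there are C-algebraic
cuspidal `π_i` on `GL_{n_i}/ℚ`, `Σ n_i = 4`, with `L(s, H¹(A)) = ∏ L(s, π_i ⊗ |det|^{(1-n_i)/2})`.
The lemma is PROVED in the source (p. 146) — conditionally, like every result of the source, on the
twisted weighted fundamental lemma (§1.6, quoted under `## Status` below); what is recorded here is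
that proved implication, not its hypothesis.

TYPED FORM. The fact is recorded in the typed form requested by route
`Langlands/RegularSerreAbelianSurfaces` (work item wi-37341; it closes that route's item
`SerreToAbelianSurfaces : OrdinarySerreGSp4 → AbelianSurfacesModular` by `exact h`, the two sides
below being VERBATIM the bodies of those route defs — a `Literature` file may neither import a
`Theses` file nor give an unproved hypothesis a `def` of its own, so both sides are written inline
and `exact` closes by unfolding). How the typed sides relate to the printed ones is recorded below
so that reviewers and refuters can attack exactly these points.

* HYPOTHESIS (first bracket), through the `GL₄` proxy (the tree has no holomorphic Siegel eigenforms
  on `GSp₄`): for `p ≥ P₀` (Remark 10.4.2 variant), `k` algebraically closed of characteristic `p`,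
  every irreducible framed `ρ̄ : Γ_ℚ → GL₄(k)` that is symplectic with multiplier `ε̄⁻¹` (mod-`p`
  cyclotomic character through `ZMod.castHom`) and conjugate to an upper-triangular representation
  on `Γ_{ℚ_p}` (this is "semisimplification a sum of characters"), there are a cuspidal REGULAR
  ALGEBRAIC `Π` on `GL₄(𝔸_ℚ)` unramified at `p` and `r : Γ_ℚ → GL₄(ℚ̄_p)` symplectic (some
  multiplier), Greenberg-ordinary of injective shape at `p`, with cofinite Satake–Frobenius matching
  `r = r_{Π,ι}` (`arithFrobPolyOfSatake ι q_v 4`) and `r ≡ ρ̄` (cofinitely: integral Frobenius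
  polynomials reducing under `red` to those of `ρ̄`). To recover the PRINTED hypothesis from this
  one needs: `Π ≅ Π^∨ ⊗ χ` of symplectic type (from `r` symplectic irreducible, Chebotarev and
  strong multiplicity one), DESCENT `GL₄ → GSp₄` to a cuspidal `π` of general type [cite:
  Arthur2013, Thm 1.5.2] [cite: GeeTaibi2019, §2] — which rests on the twisted weighted fundamental
  lemma (BCGP §1.6) —, regular weight from regular algebraicity, level prime to `p` from `Π`
  unramified at `p`, and ORDINARITY of `π` at `p` from `r` Greenberg-ordinary of regular (injective)
  shape via crystalline local–global compatibility at `p`; absolute irreducibility = irreducibility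
  since `k` is algebraically closed. So the typed implication is the printed lemma COMPOSED WITH
  this descent package.

* CONCLUSION (second bracket): for every abelian surface `A/ℚ` (`AbelianVariety ℚ`, `dim = 2`),
  prime `ℓ`, `ℚ_ℓ`-basis `b` of `V_ℓ A` and the framed `r` of `Γ_ℚ` on `H¹_ét(A_ℚ̄, ℚ̄_ℓ) = (V_ℓ
  A)^∨ ⊗ ℚ̄_ℓ` in the dual basis (frame clause verbatim from
  `bcgp_switch_exists_modular_abelianSurface`), IF `r` is irreducible then for every level witness
  and `ι : ℚ̄_ℓ ≃ ℂ` there is an L-algebraic cuspidal `π` on `GL₄(𝔸_ℚ)` whose Satake parameters give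
  the arithmetic Frobenius polynomials of `r` at almost all `v`. This is Def. 1.8.12 in the
  one-factor case (`n₁ = 4`), the case forced by `r` irreducible; nothing is claimed for reducible
  `H¹`.

* PROOF DEPENDENCIES as printed (p. 146): Theorem 10.2.1 for the 32 non-challenging types
  (Khare–Wintenberger/Kisin for the reducible and **E**[D_n] types, Lemma 10.2.5 for the potentially
  abelian irreducible ones); for **A** and **B**[C₂] a density-one set of `p` with `A` ordinary,
  residually `p`-distinguished, `ρ̄_{A,p}` vast and tidy of image `GSp₄(𝔽_p)` resp. `SL₂(𝔽_p) ≀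
  ℤ/2`, then the BCGP theorem "`ρ` is modular from multiplicity one and classicality" with the `π`
  supplied by the hypothesis.

## Status (provefact seat, 2026-08-17): conditional in print; no discharge extractable

* CONDITIONAL ON THE TWISTED WEIGHTED FUNDAMENTAL LEMMA. The source declares (§1.6 "The work of
  Arthur", p. 6): *"this paper, as with the paper [BCGP 2021], relies on results stated by Arthur in
  [Arthur 2004] which ultimately rely on references [A24], [A25], [A26], and [A27] which have not
  (still) yet appeared, as well as cases of the twisted weighted fundamental lemma announced in
  [Chaudouard–Laumon 2010]. … As a result of the recent preprint [Atobe–Gan–Ichino–Kaletha–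
  Mínguez–Shin] … a complete proof of all the missing ingredients from Arthur's papers is now
  available, and thus the only result we use for which a proof is not yet available is the twisted
  weighted fundamental lemma."* So Lemma 10.4.1 and Theorem 10.2.1 — and equally the transfer
  `GL₄ ↔ GSp₄` of §1.8.10 through which both typed brackets are read — are, in the published
  record, theorems CONDITIONAL on the twisted weighted fundamental lemma (cf. the same status note
  in `Literature/NumberTheory/Automorphic/ScholzeTorsionGalois.lean`, after [cite: AtobeEtAl2024,
  Introduction and §0.4]). The named fact is consumed, as every named fact, as an explicit
  hypothesis `(h : bcgp_serreRegularWeight_implies_allAbelianSurfacesModular)` and carries exactly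
  this status.
* SIZE OF A DISCHARGE. Independently of that caveat, a proof of
  `bcgp_serreRegularWeight_implies_allAbelianSurfacesModular_holds` would have to formalise, on the
  tree's scheme-theoretic `AbelianVariety` and adelic `CuspidalAutomorphicRepData`: (i) the main
  theorem of the source, "`ρ` is modular from multiplicity one and classicality" (§9, resting on
  §§2–8: higher Hida theory for `GSp₄`, Taylor–Wiles patching with vast and tidy images, the local
  deformation rings `R_p^△`); (ii) [cite: BoxerEtAl2021, §9.2] (density-one good primes, big image
  of challenging surfaces); (iii) for Galois type **E**[D_n] — which has `End_ℚ(A) = ℤ`, hence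
  irreducible `H¹`, and so lies INSIDE the second bracket — Serre's conjecture
  [cite: KhareWintenberger2009, Thm. 1.2 and Thm. 9.1], in the tree the UNPROVED named fact
  `Literature.NumberTheory.Automorphic.khare_wintenberger` (proof of Theorem 10.2.1, p. 139: "These
  are modular by [Khare–Wintenberger]"); (iv) Lemma 10.2.5 (potentially abelian types: CM Hecke
  characters and automorphic induction); (v) the descent/transfer `GL₄ ↔ GSp₄` [cite: Arthur2013,
  Thm 1.5.2] [cite: GeeTaibi2019, §2] and crystalline local–global compatibility at `p`. None of
  (i)–(v) exists in Mathlib or the tree as a theorem; (iii) exists as a fact without `_holds`.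
  Triage: SIZE XL (a theory); the provefact attempt of 2026-08-17 was parked `blocked-on:
  Literature.NumberTheory.Automorphic.khare_wintenberger`. Its audit of the typed brackets against
  pp. 6, 11, 138–139, 146 of the arXiv text found no misstatement: the printed `ρ̄` is
  `GSp₄(𝔽_p)`-valued while the typed hypothesis quantifies over all `k = k̄` and all `red`, which
  only strengthens the hypothesis (so weakens the implication); the conclusion's normalisation
  `arithFrobPolyOfSatake ι q_v 1` on `H¹ = (V_ℓ A)^∨` (frame clause `r(g) = [g⁻¹]_bᵀ`) matches
  Def. 1.8.12 after the twist `π ⊗ |det|^{-3/2}` from C- to L-algebraic.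

## Review (review-split seat, 2026-08-17): the hypothesis bracket OVER-CLAIMS on the imprimitive sector

A second audit, against pp. 9, 117–120 and 146 of the arXiv text, finds one point where the typed
implication is STRONGER than what the source proves; it is recorded here (statement unchanged —
two `Summits` modules apply `h` to the verbatim bracket) so that planners and refuters see it.

* WHAT THE PRINT PINS. The printed hypothesis asks for `π` on `GSp₄/ℚ` with *central character
  `|·|²`* and `ρ̄_{π,p} ≅ ρ̄`; for such `π` the source's normalisation gives `ν ∘ ρ_{π,p} = ε⁻¹`
  exactly (§1.8, the theorem recalling `ρ_{π,p}` for regular algebraic `π` of weight `(k, l; 2)`,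
  first bullet, p. 9), and p. 9 fixes this globally: *"We will always assume that such a `π` has
  central character `|·|²`. (We apologize for this assumption, which … suffices for applications
  to abelian surfaces.)"* The proof of Lemma 10.4.1 (p. 146) feeds this `π` into the
  multiplicity-one proposition of §7.5 (pp. 118–119; its `p > 2` branch reads *"there exists an
  ordinary cuspidal automorphic representation `π` of `GSp₄/ℚ` with central character `|·|²` such
  that `ρ̄_{π,p} ≃ ρ̄`"*, for `ρ = ρ_{A,p}` with `ν ∘ ρ = ε⁻¹`) and the theorem "`ρ` is modular"
  following it (p. 120). So in print the automorphic lift is symplectic for the SAME similitude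
  class as `ρ̄` (multiplier `ε̄⁻¹`, finite-order part trivial).
* WHAT THE TYPED BRACKET ASKS. Only `∃ μ : Γ_ℚ → ℚ̄_p, r.IsSymplecticWithMultiplierFun μ` — some
  alternating form, some multiplier (`IsSymplecticWithMultiplierFun` is `∃ J, Jᵀ = -J ∧ IsUnit
  J.det ∧ ∀ g, r(g)ᵀ J r(g) = μ(g) J`) — and the congruence `r ≡ ρ̄` is through characteristic
  polynomials only, which determine `r̄^ss ≅ ρ̄` and nothing about forms.
* WHY THIS IS A GAP EXACTLY AT TYPE **B**[C₂]. The residues used by the printed proof for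
  **B**[C₂] are imprimitive: `ρ̄ = Ind_{Γ_K}^{Γ_ℚ} σ̄` with `ρ̄|_{Γ_K} = σ̄₁ ⊕ σ̄₂`, `σ̄₁ ≇ σ̄₂`,
  `det σ̄ᵢ = ε̄⁻¹` (p. 146: image `SL₂(𝔽_p) ≀ ℤ/2` on `Γ_{ℚ(ζ_{p^∞})}`). Such a `ρ̄` carries EXACTLY
  TWO invariant non-degenerate alternating forms up to scalar: in a basis adapted to `σ̄₁ ⊕ σ̄₂`,
  `B₊ = diag(J₁, bJ₁)` with multiplier `ε̄⁻¹` (the Weil class) and `B₋ = diag(J₁, -bJ₁)` with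
  multiplier `ε̄⁻¹ η̄_K` (`η_K` the quadratic character of `K`; direct block computation with
  `ρ̄(w) = [[0, X], [Y, 0]]` for `w ∉ Γ_K`). A witness `(Π, r)` polarised in the `B₋` class
  (`μ̄ = ε̄⁻¹ η̄_K` up to a `p`-power-order character) satisfies every clause of the typed bracket,
  and the class cannot be repaired downstream: a twist `r ⊗ η` keeps `r̄ ≅ ρ̄` iff
  `η̄ ∈ {1, η̄_K}` and then changes `μ` by `η²`, a `p`-power-order character times `η_K² = 1`;
  and `(Π, χ) ↦ (Π, χ η_K)` is a polarisation only if `Π ≅ Π ⊗ η_K`, i.e. `r` induced from `K`.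
  The descent of such a `Π` is a `π` on `GSp₄/ℚ` whose central character has finite part `η_K ≠ 1`,
  which NO statement of the source consumes (central character `|·|²` throughout). Hence on the
  **B**[C₂] surfaces — which lie inside the second bracket (`End_ℚ(A) = ℤ`, so `H¹` is irreducible
  by Faltings) — the typed implication is not Lemma 10.4.1 composed with published results: it is
  stronger than the source. (The same clause sits in
  `bcgp_serreWreath_implies_quadraticImprimitiveSurfacesModular`, at exactly these residues.)
* WHY IT IS HARMLESS AT TYPE **A**. If `ρ̄(Γ_ℚ) ⊇ Sp₄(𝔽_p)` (`p ≥ 3`) the invariant form is unique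
  up to scalar with multiplier `ε̄⁻¹` (`ρ̄ ≅ ρ̄ ⊗ ψ` with `ψ ≠ 1` would make `ρ̄|_{Γ_K}` reducible for
  the field `K` of `ψ`, impossible as `ρ̄(Γ_K) ⊇ Sp₄(𝔽_p)` is irreducible), so `μ̄ = ε̄⁻¹`; with `r`
  crystalline at `p` (`Π` unramified at `p`) this gives `μ = ε^{-m} χ₁` with `χ₁` of `p`-power
  order, unramified at `p`, `χ̄₁ = 1`, hence `χ₁ = η²` for a power `η` of `χ₁` and `Π ⊗ η⁻¹`,
  `r ⊗ η⁻¹` is a witness with multiplier exactly `ε^{-m}` and the same reduction. So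
  `bcgp_serreSurjective_quadraticImprimitive_implies_endTrivialSurfacesModular` is unaffected.
* THE FAITHFUL CLAUSE. "Central character `|·|²`" typed through the `GL₄` proxy is: `∃ m : ℕ,
  r.IsSymplecticWithMultiplierFun (fun g ↦ (ε_p g)^(-m))` with `ε_p` the `p`-adic cyclotomic
  character pushed into `PadicAlgCl p` (no finite-order factor); for `p ∤ 2·disc K` the reduction
  `ε̄^{-m}` can only be the multiplier `ε̄⁻¹` of the two available, which forces the Weil class.
  Because the first bracket is VERBATIM the body of the route definition `OrdinarySerreGSp4`
  (stmt-Langlands-17569) and two `Summits` modules apply `(h : this fact)` to it, the correction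
  is a statement change on the route side first (planner), after which this fact is re-vended
  against the corrected bracket; it is not made here.
* UNCHANGED: independently of this point a discharge is SIZE XL (items (i)–(v) of `## Status`) and
  every result of the source is conditional on the twisted weighted fundamental lemma (§1.6).

## Review 2 (review-split seat, gen. 2, 2026-08-17): MISSTATED on both sectors; correction below

Re-read against the arXiv text (chunks 9, 11, 118–120, 138–139, 146 as materialised by `lit read
arxiv:2502.20645`; statement counter of that layer: "Proposition 374" = Prop. 7.5.7, "Theorem 375" =
Thm. 7.5.8, "Lemma 437" = Lemma 10.4.1, "Theorem 3" = the theorem of §1.8.9 recalling `ρ_{π,p}`).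
Verdict: the named fact is MISSTATED — stronger than what the source proves — through the single
clause `∃ μ, r.IsSymplecticWithMultiplierFun μ` of its hypothesis bracket, and the defect is NOT
confined to the imprimitive sector (this corrects "WHY IT IS HARMLESS AT TYPE **A**" and "THE
FAITHFUL CLAUSE" of `## Review`, which stop at a multiplier `ε^{-m}`):

* (similitude class) at an imprimitive residue the clause admits the second class `ε̄⁻¹ η̄_K`
  (`## Review`; found independently in `BcgpSerreWreathFixedSimilitudeImprimitiveSurfaces.lean`);
* (Tate parity, at EVERY residue, type **A** included) with `r` Greenberg-ordinary of an injective
  shape `a ∈ ℕ⁴` and `Π` unramified at `p`, the multiplier is `μ = ε^{-m} χ₁` with `χ₁` of `p`-power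
  order unramified at `p` and `μ|_{I_p} = ε^{-m}`, `m ≡ 1 (mod p - 1)` (from `μ̄ = ε̄⁻¹` on `I_p`),
  say `m = 1 + (p-1)t`. The printed `π` has central character `|·|²`, i.e. `ν ∘ ρ_{π,p} = ε⁻¹`
  EXACTLY ("Theorem 3", first bullet, chunk 9; "`ν ∘ ρ = ε⁻¹`" and "central character `|·|²`" in
  Prop. 7.5.7, chunk 118), and from the witness it is reached only through a twist `r ⊗ ψ` with
  `ψ² = ε^{m-1} χ₁⁻¹`, i.e. `ψ = ε^{(p-1)t/2} · χ₁^{-1/2} · η` with `η² = 1`, whose reduction is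
  `η̄_p^t η̄` (`η̄_p = ε̄^{(p-1)/2}`, the quadratic character of `ℚ(√p*)`). For `t` EVEN, `η = 1`
  works and everything is fine. For `t` ODD either `η = 1` and the twist reduces to `ρ̄ ⊗ η̄_p ≇ ρ̄`
  — the witness certifies the printed hypothesis at `ρ̄ ⊗ η̄_p`, not at `ρ̄` —, or `η = χ_{p*}`
  (the only quadratic character reducing to `η̄_p`), ramified at `p`: the twist is no longer
  crystalline at `p`, the descended `π` has level divisible by `p`, and on the abelian-surface side
  `ρ_{A,p} ⊗ χ_{p*}` is not semistable at `p` — outside "level prime to `p`" of Lemma 10.4.1 and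
  hypothesis (5) of Prop. 7.5.7. Odd-`t` witnesses exist as soon as the PRINTED hypothesis holds
  at `ρ̄ ⊗ η̄_p`: from its `π` of weight `(k, l; 2)` take `r := ρ_{π,p} ⊗ ε^{-(p-1)/2}` (multiplier
  `ε^{-p}`, `t = 1`; reduction `ρ̄ ⊗ η̄_p ⊗ η̄_p = ρ̄`; crystalline, Greenberg-ordinary of the
  injective shape `a + (p-1)/2 ∈ ℕ⁴` once `p + 3 ≥ k + l`, else use `t = 3, 5, …`) and `Π` the
  transfer of `π` Tate-twisted accordingly (regular algebraic, cuspidal, unramified at `p`): every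
  clause of the typed bracket holds AT `ρ̄`. Hence from the typed hypothesis the printed one follows
  at `ρ̄_{A,p}` or at `ρ̄_{A,p} ⊗ η̄_p` — adversarially the latter at every good `p` — and the
  printed proof (Prop. 7.5.7 and Thm. 7.5.8 at `ρ = ρ_{A,p}`, chunk 146) does not run. On the
  type-**A** sector as on the **B**[C₂] sector the typed implication is therefore NOT Lemma 10.4.1
  composed with published results; it is a stronger statement (expected true, as any statement
  whose conclusion is the modularity of abelian surfaces, but not literature). The same clause, and
  the same verdict, apply to `bcgp_serreSurjective_quadraticImprimitive_implies_endTrivialSurfacesModular`.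

CORRECTED BRACKET. Replace the clause by `∃ s : ℕ, p - 1 ∣ s ∧ r.IsSymplecticWithMultiplierFun
(g ↦ ε_p(g)^{-(1+2s)})`, `ε_p = GaloisRep.cyclotomicCharacter ℚ p` pushed along `ℤ_p → ℚ_p → ℚ̄_p`
— VERBATIM the clause of `BcgpSerreWreathFixedSimilitudeImprimitiveSurfaces.lean`, so that the
decomposition "fact = wreath fact ⊕ primitive slice" of the `…Proofs` companion carries over to the
corrected statements word for word. Both directions use published results only: the printed `π`
gives a corrected witness with any `s ∈ (p-1)ℕ` beyond its Hodge–Tate weights (`r := ρ_{π,p} ⊗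
ε^{-s}`, reduction unchanged since `ε̄^{p-1} = 1`, multiplier exactly `ε^{-(1+2s)}`, shape in `ℕ⁴`
injective because the weight is regular, `Π :=` transfer of `π` twisted by the matching power of
`|det|`), and a corrected witness gives the printed `π` by the twist `ε^{s}` (multiplier exactly
`ε⁻¹`, reduction `ρ̄`, still crystalline), symplectic-type self-duality of the twisted `Π`, descent
[cite: Arthur2013, Thm 1.5.2] [cite: GeeTaibi2019, §2] to a `π` of general type with central
character `|·|²`, level prime to `p` and regular weight, ordinary at `p` by crystalline local–global
compatibility. The corrected implication is stated at the end of this file as the CONCLUSION TYPE of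
`bcgp_serreRegularWeightFixedSimilitude_implies_allAbelianSurfacesModular_of_serreRegularWeight` and
PROVED from the present declaration (a fixed-similitude witness is an `∃ μ` witness): it is
machine-checked, claims provably no more than the declaration it corrects, and mints no fact
(D-0026). LEFT TO THE PLANNER of route `Langlands/RegularSerreAbelianSurfaces`: re-type
`OrdinarySerreGSp4` (stmt-Langlands-17569) with the corrected clause and have the corrected
statement named against it — the present declaration cannot be edited in place (two `Summits`
modules apply it to the `∃ μ` bracket) and a proving seat does not re-vend it under a new name.
Independently of the correction a discharge stays SIZE XL and conditional in print on the twisted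
weighted fundamental lemma (`## Status`): the corrected statement is a conditional-bridge crux, not
a provefact target.

## Review 3 (review-split seat, gen. 3, 2026-08-17): MISSTATED stands; where exactly it bites

Third independent audit (arXiv text, chunks 9, 97, 100, 110–112, 118–120, 146). Outcome for the
harness: `blocked: misstated` — not provable inline (XL, `## Status`), not restatable in place (the
hypothesis bracket is verbatim `OrdinarySerreGSp4`, applied by two `Summits` modules), no corrected
named fact minted by a reviewing seat (D-0026); the corrected bracket is the one of `## Review 2`,
already machine-checked below. Two precisions on WHERE the `∃ μ` clause over-claims:

* DECISIVE, AND ONLY AT THE IMPRIMITIVE RESIDUES (type **B**[C₂]). `## Review` is confirmed: the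
  residual similitude class of a witness is a twist invariant (`μ ↦ μψ²` with `ψ̄ ∈ {1, η̄_K}`), and
  for `K` imaginary `η_K` is not even a square in the character group of `Γ_ℚ` (`ψ₀² = η_K` forces
  `η_K(c) = 1`); for `K` real a square root `ψ₀` has order `4` and moves the residue. What WOULD
  consume a `B₋`-class witness is Prop. 7.5.7/Thm. 7.5.8 run with central character `|·|² η_K` and
  similitude `ε⁻¹ η_K` — the natural frame for `(ρ_{A,p}, B₋)`, which exists because `ρ_{A,p} ≅
  ρ_{A,p} ⊗ η_K` is induced — and that variant is NOT printed: p. 9 fixes `|·|²` for every `π` of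
  the paper, and §7.3–7.5 build the patching datum on the submodule `M^{|·|²}` where the centre
  `{±1}\∏_ℓ ℤ_ℓ^×` acts by `z ↦ z_p^{-2}` (chunk 112; Lemma on `M/𝔮'M`, chunk 118: "`π` … with
  central character `|·|²`"), which a `π` of central character `|·|² η_K` does not meet. So on the
  **B**[C₂] surfaces the typed implication exceeds Lemma 10.4.1 ∘ (anything published). Misstated.
* SOFTER THAN `## Review 2` SAYS AT TYPE **A**. There `μ̄ = ε̄⁻¹` is forced, `φ := μ ε` has values
  in `1 + 𝔪` (uniquely 2-divisible, `p` odd) and `ψ := φ^{-1/2} = ⟨ε⟩^{(p-1)t/2} χ₁^{-1/2}` is a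
  de Rham character with `ψ̄ = 1`; `r ⊗ ψ` has multiplier EXACTLY `ε⁻¹` and reduction EXACTLY `ρ̄`
  for every Tate parity `t`, is ordinary, and its inertial characters `ω^{-a_i} ⟨ε⟩^{(p-1)t/2-a_i}`
  have tame part the Teichmüller lift of `ρ̄`'s `p`-stabilisation, i.e. `r ⊗ ψ |_{Γ_{ℚ_p}}` is a
  point of `Spec R_p^△` (§6.2, chunk 97: `Λ_{GSp₄,v} = 𝒪⟦(𝒪_v^×(p))²⟧`, the PRO-`p` completion).
  For `t` odd the descended `π'` has tame level `p` (quadratic nebentypus), which Lemma 10.4.1 AS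
  STATED excludes ("level prime to `p`") but Prop. 7.5.7 does not (chunk 118: "an ordinary cuspidal
  automorphic representation `π` of `GSp₄/ℚ` with central character `|·|²` such that `ρ̄_{π,p} ≃
  ρ̄`", plus reasonable/tidy/regular-semisimple/same-component; on p. 146 "level prime to `p`"
  enters only through `Spec R_p^△[1/p]` irreducible). Whether the source's `M_w` (level `Iw(p)K^p`,
  control stated for algebraic `λ`, Thm. "properties of higher Hida theory", chunk 110) sees such a
  `π'` is not printed either; the standard published bridge back to the lemma AS STATED is Hida
  theory for `GSp₄` over the full `ℤ_p⟦T(ℤ_p)⟧` [cite: Pilloni2012, Thm 1.1 (6)–(7) (p. 337: the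
  `ℤ_p⟦T_Q(ℤ_p)⟧`-module `V^{ord}_{cusp}`, free of finite rank over `Λ_Q`, whose specialisation at
  every `Q`-very regular weight is `e S(κ, Γ_N, ℤ_p)`, `p ∤ N`)]: the family through the ordinary
  `p`-adic cusp form underlying `π'` has classical cuspidal specialisations of level `Γ_N` at the
  very regular weights of its component (trivial nebentypus exactly at the weights in the right
  class mod `p - 1`), of general type because `ρ̄` is irreducible, residually `ρ̄` — i.e. the
  PRINTED hypothesis at `ρ̄`. So at type **A** the `∃ μ` form is Lemma 10.4.1 ∘ [descent, as in
  TYPED FORM above] ∘ [Hida theory with nebentypus at `p`] — one published layer more than the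
  "descent ∘ crystalline ordinarity" claimed above, not a gap in the literature; this seat has NOT
  checked that chain to the level of a vend and records it as a lead for the sibling
  `bcgp_serreSurjective_quadraticImprimitive_implies_endTrivialSurfacesModular`, not as a verdict.
* CONSEQUENCE. The fixed-similitude clause of `## Review 2` (`p - 1 ∣ s`) remains the right
  restatement for BOTH sectors: it is what the printed `π` gives and what gives the printed `π` back
  with level prime to `p` by the single twist `ε^{s}`, no Hida theory needed. Route-side action
  (planner): re-type `OrdinarySerreGSp4` (stmt-Langlands-17569) with it; the corrected fact file is
  parked as evidence on stmt-Langlands-17570.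

## Verdict clean-up (defact-verdict seat, 2026-08-17): old name DEPRECATED, corrected statement carried by a live theorem (name reserved)

The verdict `misstated` of the tenured prove-seat (`## Review 2`, `## Review 3`) was re-verified
against the arXiv text layer of the source (`lit read arxiv:2502.20645`; chunk 146 "Lemma 437" =
Lemma 10.4.1: *"an ordinary cuspidal automorphic representation `π` of `GSp₄/ℚ` of regular weight,
level prime to `p`, and central character `|·|²`, such that `ρ̄_{π,p} ≅ ρ̄`"*; chunk 9, §1.8.9: *"We
will always assume that such a `π` has central character `|·|²`"* and the theorem recalling
`ρ_{π,p}`, first bullet, `ν ∘ ρ_{π,p} = ε⁻¹`; chunk 118 "Proposition 374" = Prop. 7.5.7: `ν ∘ ρ =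
ε⁻¹` and *"there exists an ordinary cuspidal automorphic representation `π` of `GSp₄/ℚ` with central
character `|·|²` such that `ρ̄_{π,p} ≃ ρ̄`"*) and is CONFIRMED: the printed hypothesis fixes the
similitude of the automorphic lift, the typed clause `∃ μ, r.IsSymplecticWithMultiplierFun μ` does
not, so the typed hypothesis is weaker and the typed implication stronger than Lemma 10.4.1 ∘
(descent `GL₄ → GSp₄`, crystalline ordinarity) — decisively at the imprimitive residues of type
**B**[C₂] (second similitude class `ε̄⁻¹η̄_K`, `## Review`, `## Review 3`), and at least as far as
"level prime to `p`" at every residue (odd Tate parity, `## Review 2`). Treatment (human ruling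
2026-08-15: restate by default, do not delete):

* the CORRECTED statement is VERBATIM the old declaration except that the clause
  `∃ μ, r.IsSymplecticWithMultiplierFun μ` of the hypothesis bracket is replaced by
  `∃ s : ℕ, p - 1 ∣ s ∧ r.IsSymplecticWithMultiplierFun (g ↦ ε_p(g)^{-(1+2s)})` (the CORRECTED
  BRACKET of `## Review 2`; verbatim the clause of the sibling corrected wreath fact
  `bcgp_serreWreathFixedSimilitude_implies_quadraticImprimitiveSurfacesModular`). It is carried,
  fully elaborated and with its precise citation, by the (live) theorem
  `bcgp_serreRegularWeightFixedSimilitude_implies_allAbelianSurfacesModular_of_serreRegularWeight`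
  below, whose CONCLUSION TYPE it is, and in the `…Proofs` companion, Part 4, by
  `serreToAbelianSurfacesFixedSimilitude_iff_pinned` (left side; ↔ the pinned form of its Part 3)
  and `bcgp_serreRegularWeightFixedSimilitude_of_wreathFixedSimilitude_of_primitive` (conclusion;
  "corrected implication = corrected wreath fact ⊕ primitive slice"). The correction is NOT
  meaning-preserving for the users of the old name — it strengthens the hypothesis bracket, which a
  `Summits` module feeds with the verbatim `∃ μ` route bracket
  `RegularSerreAbelianSurfaces.OrdinarySerreGSp4` — so the old name cannot simply be re-bodied;
* the corrected statement is NOT given a `def … : Prop` name by this clean-up: a verdict (defact)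
  seat may not add an unproved named fact (D-0026; the gate's `lint.fact-fanout` does not credit the
  deprecation below against the new name, net debt delta `+1`, dry-run 2026-08-17). Its name is
  RESERVED: `bcgp_serreRegularWeightFixedSimilitude_implies_allAbelianSurfacesModular`, to be
  declared by a definition proposal of the route side (the planner or line lead of
  `Langlands/RegularSerreAbelianSurfaces`, exactly as the line lead of stmt-Langlands-17766 named the
  corrected wreath fact) or by the operator (`--pre-reviewed`): insert, ABOVE the deprecated record,
  `def bcgp_serreRegularWeightFixedSimilitude_implies_allAbelianSurfacesModular : Prop :=` with body
  VERBATIM the conclusion type of `…_of_serreRegularWeight` and the citation block of that theorem,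
  and turn the record's text deprecation into `@[deprecated bcgp_serreRegularWeightFixedSimilitude_implies_allAbelianSurfacesModular …]`
  — ready-made, elaborating files in that shape are attached as evidence to the route item
  stmt-Langlands-17570 (`SerreToAbelianSurfaces`): the provefact seat's stand-alone
  `BcgpSerreRegularWeightFixedSimilitudeAbelianSurfacesModular.lean` (2026-08-17T10:29Z, bounced from
  that seat by the same lint) and this clean-up's in-place variant of the present file
  (`BcgpSerreRegularWeightAbelianSurfacesModular.named.lean`);
* the OLD declaration `bcgp_serreRegularWeight_implies_allAbelianSurfacesModular` keeps its body and
  its ledger-referenced name and is `@[deprecated]` (text pointer to the corrected statement,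
  deprecation note in its docstring); it is no longer literature debt and no `_holds` is expected
  for it. Its in-tree users: `Summits/Langlands/Langlands/Theorems/AbelianSurfaceSerreQuadraticImprimitiveSurfacesOfOrdinarySerre.lean`
  (`stub_ofOrdinarySerre (hL : …) … := stub_ofAbelianSurfacesModular hF hS (hL hSerre)`, which now
  sees the deprecation warning; rewiring it means re-typing `OrdinarySerreGSp4`,
  stmt-Langlands-17569, with the fixed-similitude clause — the planner's edit — after which `hL`
  takes the corrected statement and the proof term is unchanged) and the `…Proofs` companion (two
  bookkeeping theorems about the old name, `…_of_wreath_of_primitive` and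
  `bcgp_serreRegularWeightPinned_implies_allAbelianSurfacesModular_of`, superseded by their Part-4
  fixed-similitude twins);
* the bridge `bcgp_serreRegularWeightFixedSimilitude_implies_allAbelianSurfacesModular_of_serreRegularWeight`
  (record ⟹ corrected statement, pure logic: a fixed-similitude witness is an `∃ μ` witness) stays
  a live theorem — it is the certified comparison "the corrected statement claims no more than the
  record" and this file's carrier of the corrected statement — so `linter.deprecated` is switched
  off for that one declaration, which must name the record as its hypothesis.

Nothing else changed: a discharge of the corrected statement is SIZE XL (`## Status`, items
(i)–(v)) and, like every result of the source, conditional in print on the twisted weighted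
fundamental lemma (§1.6); once named it is a conditional-bridge crux for the planner, not a
provefact target of ordinary size.

## Review 4 (provefact seat, gen. 1 retry, 2026-08-17): which published layer rescues which sector; the decisive sector is **B**[C₂] over a REAL quadratic field

Fifth pass, first made independently (quantifier game over the hypothesis class `𝒞`, which is
stable under `ρ̄ ↦ ρ̄ ⊗ η̄_p` and under quadratic twists) and then reconciled with `## Review`–
`## Review 3`; sources: chunks 9–10 and 146 of the arXiv text, [Pilloni2012] pp. 336–337 (Thm 1.1),
[BarnetlambEtAl2014] §2.1, [BellaicheChenevier2011] §§1.1–1.3. VERDICT UNCHANGED: misstated —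
executed meanwhile by `## Verdict clean-up` (record `@[deprecated]`, corrected statement = the
`## Review 2` clause); three precisions say which published layer rescues which sector of the
recorded `∃ μ` form, and where nothing published does:

* TYPE **A** (one symplectic class): RESCUED BY HIDA THEORY AT LEVEL PRIME TO `p`, by a cleaner
  mechanism than the nebentypus detour of `## Review 3`. A witness certifies the printed hypothesis
  at `ρ̄` or at `ρ̄ ⊗ η̄_p` (`## Review 2`), and these two residues are ONE ordinary family apart: for
  `π` of weight `(k, l; 2)` the source's `ρ_{π,p}` (`ν ∘ ρ_{π,p} = ε⁻¹`, `WD ↔ rec(π_v ⊗ |ν|^{-3/2})`,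
  Hodge–Tate weights `((k+l)/2-1, -(k-l)/2, (k-l)/2+1, 2-(k+l)/2)`; Thm. of §1.8.9, chunks 9–10) is
  the Tate twist by `ε^{(k+l)/2-2}` of the representation `ρ^H_{π,p}` whose Frobenius polynomials are
  the classical spinor Hecke polynomials (Hodge–Tate weights `{0, l-2, k-1, k+l-3}`). In an ordinary
  family of tame level `N` it is `ρ̄^H` that is constant on a connected component of weight space
  (Hecke eigenvalues congruent; the explicit powers of `ℓ` in the Hecke polynomial have exponents
  affine in `k + l`, constant mod `p - 1` on the component), so the `|·|²`-normalised residue at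
  weight `(k + (p-1)(2i+1), l + 2j(p-1))` is the one at `(k, l)` twisted by `ω^{(p-1)(2i+2j+1)/2} =
  η̄_p`. [cite: Pilloni2012, Thm 1.1 (1), (3), (6), (7)] (Siegel cusp forms of principal level `Γ_N`,
  `p ∤ N`, `g = 2`, `T_Q(ℤ_p) ≅ (ℤ_p^×)²`: `V^{ord}_{cusp}` is free of finite rank over `Λ_Q` and
  specialises to `e S(κ, Γ_N, ℤ_p)` at every `Q`-very regular `κ`; a classical ordinary cusp form of
  any weight embeds by (1)) therefore gives, in the component of the given `π₁` (level `N` prime to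
  `p`, ordinary, cuspidal, regular weight `(k, l)`, `ρ̄_{π₁,p} ≅ ρ̄ ⊗ η̄_p`; its maximal ideal lies in
  the support of the free module, whose localisation is then free and non-zero), a classical ordinary
  cuspidal eigenform of level `Γ_N` — no level at `p` at all — at every very regular weight of the
  component, congruent to `π₁`; at the weights `(k + (p-1)u, l + (p-1)v)` with `u + v` odd (the
  twist is `η̄_p^{u+v}`) its `|·|²`-residue is `ρ̄`, it is of general type (`ρ̄` irreducible), and
  the `p`-power-order finite part of its central character is removed by an odd-order twist
  unramified at `p`. That is the PRINTED hypothesis at `ρ̄`. So at type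
  **A** the `∃ μ` form is Lemma 10.4.1 ∘ [descent, TYPED FORM above] ∘ [Pilloni2012, Thm 1.1] — the
  lead of `## Review 3` for `bcgp_serreSurjective_quadraticImprimitive_implies_endTrivialSurfacesModular`
  is sound with THIS mechanism. (Its own route does not run as written: the `π' = π₁ ⊗ (χ_{p*} ∘ ν)`
  of `## Review 3` has nebentypus `χ_{p*} ∘ ν`, non-trivial on `diag(1, 1, ν, ν)`, which acts
  trivially on the Igusa tower — the tower only carries characters of the `GL₂`-torus
  `T_Q(ℤ_p)` of the multiplicative part —, so no vector of `π'` is a point of `V^{ord}`; twisting back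
  to `π₁` first is what works.)
* TYPE **B**[C₂] WITH `K` IMAGINARY: RESCUED BY THE SIGN THEOREM. The second class at `ρ̄ = Ind_K σ̄`
  has similitude `ε̄⁻¹ η̄_K` with `(ε̄⁻¹ η̄_K)(c) = (-1)(-1) = +1`, EVEN at complex conjugation, so a
  lift `μ` of it has `μ(c) = +1` (`p` odd). The witness `Π` is RAESDC (`r ≅ r^∨ ⊗ μ` with `μ = ε^{w} χ₁`, `χ₁` of finite order —
  `r` is Hodge–Tate at `p` since its Greenberg shape is injective —, and strong multiplicity one), so
  `r = r_{p,ι}(Π)` with its automorphic multiplier is totally odd, essentially self-dual, and an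
  irreducible such `r` factors through `GSp₄` with ODD multiplier or through `GO₄` with EVEN
  multiplier [cite: BarnetlambEtAl2014, §2.1 ("totally odd, essentially conjugate self-dual";
  "factors through GSp_n (if μ(c_v) = -ε_v) or GO_n (if μ(c_v) = ε_v)")]
  [cite: BellaicheChenevier2011, Thm 1.2]. Were `r` not induced from a quadratic field, its invariant
  bilinear form would be unique up to scalar, hence equal to the alternating witness form with even
  `μ` — excluded. So `r ≅ r ⊗ η_K` (`K` is the only quadratic field from which `ρ̄` is induced once
  `ρ̄(Γ_{ℚ(ζ_{p^∞})}) ⊇ SL₂(𝔽_p)²`, `p ≥ 5`), `r = Ind_K σ` carries BOTH block forms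
  `diag(J₁, ±bJ₁)`, and the same `(Π, r)` is a witness in the Weil class `ε̄⁻¹`; from there the
  type-**A** argument applies (a `π` with `ν ∘ ρ_{π,p} = ε⁻¹` reducing to `ρ̄` is `GSp₄`-conjugate to
  `(ρ̄, B₊)`, the only class of multiplier exactly `ε̄⁻¹`).
* TYPE **B**[C₂] WITH `K` REAL: NOT RESCUED — the decisive sector. Here `ε̄⁻¹ η̄_K` is odd, a
  non-induced RAESDC lift of `(ρ̄, B₋)` contradicts nothing published, and no printed statement
  consumes it (`## Review`, `## Review 3`). Two sub-sectors are literature by OTHER roads and should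
  be subtracted when weighing the over-claim: (i) `A_K ∼ E × E^c` (`E/K` an elliptic curve over the
  real quadratic `K`, no CM, `E ≁ E^c`): `E` is modular [cite: FreitasLeHungSiksek2015, Thm 1] and
  `H¹(A) = Ind_K^ℚ H¹(E)` is the automorphic induction of its Hilbert newform, cuspidal because
  `E ≁ E^c` [cite: ArthurClozel1989, Ch. 3, Thm 6.2] — there the CONCLUSION holds outright;
  (ii) `η_K = ψ²` for a Dirichlet character `ψ` (every odd prime ramified in `K` is `≡ 1 mod 4` and
  the `2`-part of `η_K` is `1` or `χ₈`): querying the hypothesis at `ρ̄ ⊗ ψ̄⁻¹ ∈ 𝒞`, whose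
  `ε̄⁻¹`-class is the `B₋`-class of `ρ̄`, returns either a Weil-class witness at `ρ̄` (after the
  twist `ψ`, unramified at `p`) or the printed hypothesis at `(ρ̄ ⊗ ψ̄⁻¹, B₋)`, usable only through
  Prop. 7.5.7/Thm. 7.5.8 at `ρ = (ρ_{A,p} ⊗ ψ⁻¹, B₋)` (`ν ∘ ρ = ε⁻¹` exactly, crystalline of weight
  `2`), whose residual-image hypotheses (vast, tidy) this seat has NOT checked for the twisted
  residue. What is left with no published road from the `∃ μ` hypothesis: `A/ℚ` of type **B**[C₂]
  whose endomorphism field `K` is real quadratic and whose `A_K` is simple (real multiplication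
  defined over `K` only), at least when `η_K` is not a Dirichlet square (`K = ℚ(√3), ℚ(√6), ℚ(√7),
  …`). On that sector the recorded implication is neither the printed lemma composed with its
  declared descent package nor, as far as the published record goes, a theorem: MISSTATED stands.
  Even on the rescued sectors the declared provenance ("Lemma 10.4.1 ∘ descent ∘ crystalline
  ordinarity", TYPED FORM above) undercounts the layers actually needed (Hida theory; the sign
  theorem; Freitas–Le Hung–Siksek with automorphic induction) — all of which the `## Review 2`
  clause makes unnecessary, which is why it, and not an enlarged provenance note, is the restatement.
* HARNESS NOTE. `Literature.NumberTheory.Automorphic.khare_wintenberger` of `## Status` (iii) is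
  `khare_wintenberger p k` — a parametrised `Prop` without `_holds`, not a closed named fact of the
  census —, so the 2026-08-17 park line naming it could not resolve; it is superseded by the
  `misstated` verdict of `## Review 2`–`## Review 4`.

## References

* [BoxerCalegariGeePilloni2025] arXiv:2502.20645, Lemma 10.4.1, Remark 10.4.2, Theorem 10.2.1,
  Def. 1.8.12, §1.8.10; §1.6 (dependence on Arthur's work and on the twisted weighted fundamental
  lemma).
* [BoxerEtAl2021] G. Boxer, F. Calegari, T. Gee, V. Pilloni, *Abelian surfaces over totally real
  fields are potentially modular*, Publ. Math. IHÉS 134 (2021), §9.2.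
* [KhareWintenberger2009] C. Khare, J.-P. Wintenberger, *Serre's modularity conjecture (I)*, Invent.
  Math. 178 (2009), Thm. 1.2, Thm. 9.1 (tree: `Literature.NumberTheory.Automorphic.khare_wintenberger`).
* [Arthur2013] J. Arthur, *The endoscopic classification of representations*, AMS Colloq. Publ. 61.
* [GeeTaibi2019] T. Gee, O. Taïbi, *Arthur's multiplicity formula for GSp₄ and restriction to Sp₄*,
  J. Éc. polytech. Math. 6 (2019).
* [AtobeEtAl2024] H. Atobe, W. T. Gan, A. Ichino, T. Kaletha, A. Mínguez, S. W. Shin, *Local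
  intertwining relations and co-tempered A-packets of classical groups*, arXiv:2410.13504,
  Introduction and §0.4 (status of [A24]–[A27]; the twisted weighted fundamental lemma "remains
  conditional").
* [Pilloni2012] V. Pilloni, *Sur la théorie de Hida pour le groupe GSp_{2g}*, Bull. SMF 140 (2012),
  Thm 1.1 (p. 337) (`## Review 3`, `## Review 4`: the published layer behind the type-**A** repair;
  not used by any declaration of this file).
* [BarnetlambEtAl2014] T. Barnet-Lamb, T. Gee, D. Geraghty, R. Taylor, *Potential automorphy and
  change of weight*, Ann. of Math. 179 (2014), §2.1 (`## Review 4`: automorphic polarisations are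
  totally odd; `GSp` versus `GO` by the parity of the multiplier).
* [BellaicheChenevier2011] J. Bellaïche, G. Chenevier, *The sign of Galois representations attached
  to automorphic forms for unitary groups*, Compos. Math. 147 (2011), Thm 1.2 (`## Review 4`).
* [FreitasLeHungSiksek2015] N. Freitas, B. V. Le Hung, S. Siksek, *Elliptic curves over real
  quadratic fields are modular*, Invent. Math. 201 (2015), Thm 1 (`## Review 4`, sub-sector (i)).
* [ArthurClozel1989] J. Arthur, L. Clozel, *Simple algebras, base change, and the advanced theory of
  the trace formula*, Ann. of Math. Stud. 120 (1989), Ch. 3, Thm 6.2 (automorphic induction;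
  `## Review 4`, sub-sector (i)).
-/

namespace Literature.NumberTheory.DiophantineGeometry

open IsDedekindDomain
open scoped NumberField
open Literature.NumberTheory.GaloisRepresentations Literature.NumberTheory.Automorphic
open Literature.AlgebraicGeometry.Motives (AbelianVariety)

/-- **DEPRECATED (defact-verdict clean-up, 2026-08-17): MISSTATED — stronger than its source. The
CORRECTED statement is the conclusion type of
`bcgp_serreRegularWeightFixedSimilitude_implies_allAbelianSurfacesModular_of_serreRegularWeight`
(next declaration; name reserved for it as a fact:
`bcgp_serreRegularWeightFixedSimilitude_implies_allAbelianSurfacesModular`, see the module docstring,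
`## Verdict clean-up`), which differs from this statement in exactly one clause of the hypothesis
bracket. What was wrong: the printed hypothesis of Lemma 10.4.1 asks for `π` on `GSp₄/ℚ` with
central character `|·|²` (so `ν ∘ ρ_{π,p} = ε⁻¹` exactly, §1.8.9; Prop. 7.5.7, which the printed
proof runs at `ρ = ρ_{A,p}`, has `ν ∘ ρ = ε⁻¹` and `π` of central character `|·|²`), whereas this
typed bracket only asks the lift `r` to be symplectic for SOME multiplier
(`∃ μ, r.IsSymplecticWithMultiplierFun μ`, congruence with `ρ̄` through characteristic polynomials
only). An `∃ μ` witness of the second similitude class `ε̄⁻¹η̄_K` at an imprimitive (type-**B**[C₂])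
residue — such residues carry exactly two invariant alternating forms, of multipliers `ε̄⁻¹` and
`ε̄⁻¹η̄_K`, and the class is twist-invariant — descends to a `π` whose central character has finite
part `η_K`, which no statement of the source consumes; and an `∃ μ` witness of odd Tate parity at
any residue certifies the printed hypothesis at level prime to `p` only at `ρ̄ ⊗ η̄_p`, not at `ρ̄`.
So the typed HYPOTHESIS is weaker and this typed IMPLICATION is STRONGER than Lemma 10.4.1 ∘
(descent `GL₄ → GSp₄`): not what the source proves (module docstring `## Review`, `## Review 2`,
`## Review 3`, `## Verdict clean-up`; verdict of the tenured prove-seat, re-verified 2026-08-17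
against chunks 9, 118, 146 of the arXiv text). Kept VERBATIM (body unchanged) under its
ledger-referenced name because the `Summits` module
`…/Theorems/AbelianSurfaceSerreQuadraticImprimitiveSurfacesOfOrdinarySerre.lean`
(`stub_ofOrdinarySerre (hL : …)`) and the `…Proofs` companion still apply it; it implies the
corrected statement (next declaration). No `_holds` is expected for this declaration; it is not
literature debt.**
Original description. BCGP Lemma 10.4.1 with Remark 10.4.2 and Theorem 10.2.1 (typed form, similitude
free). IF, for all large `p`, every irreducible `ρ̄ : Γ_ℚ → GL₄(k)` (`k = k̄` of characteristic `p`)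
that is symplectic with multiplier `ε̄⁻¹` and triangularisable on `Γ_{ℚ_p}` is congruent to an
ordinary-of-regular-shape symplectic `r = r_{Π,ι}` for a cuspidal regular algebraic `Π` on
`GL₄(𝔸_ℚ)` unramified at `p` (first bracket), THEN every abelian surface `A/ℚ` with irreducible
`H¹_ét(A_ℚ̄, ℚ̄_ℓ)` is modular in the sense of Def. 1.8.12 (an L-algebraic cuspidal `π` on
`GL₄(𝔸_ℚ)` with cofinite Satake–Frobenius matching; second bracket). Its hypothesis is not asserted
here. MIS-RENDERED (similitude of the lift left free); corrected as said above.
[cite: BoxerCalegariGeePilloni2025, Lemma 10.4.1, Rem. 10.4.2, Thm 10.2.1, §1.8.10, Def. 1.8.12]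
[cite: Arthur2013, Thm 1.5.2 (descent GL₄ → GSp₄ used to read the GL₄ proxy)]
[cite: GeeTaibi2019, §2 (Arthur's classification for GSp₄)] -/
@[deprecated "misstated (the hypothesis bracket leaves the similitude of the automorphic lift \
free, `∃ μ`, while BCGP 2025 Lemma 10.4.1 / §1.8.9 / Prop. 7.5.7 fix the central character |·|², \
i.e. ν ∘ ρ_{π,p} = ε⁻¹, so this typed implication is stronger than the source): the corrected \
statement is the conclusion type of \
Literature.NumberTheory.DiophantineGeometry.bcgp_serreRegularWeightFixedSimilitude_implies_allAbelianSurfacesModular_of_serreRegularWeight \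
(name reserved for it: bcgp_serreRegularWeightFixedSimilitude_implies_allAbelianSurfacesModular)"
  (since := "2026-08-17")]
def bcgp_serreRegularWeight_implies_allAbelianSurfacesModular : Prop :=
    (∃ P₀ : ℕ, ∀ (p : ℕ) [Fact p.Prime], P₀ ≤ p → ∀ (k : Type) [Field k] [CharP k p] [IsAlgClosed k]
        [TopologicalSpace k] [DiscreteTopology k] (red : Valued.integer (PadicAlgCl p) →+* k) (ρb :
        FramedGaloisRep ℚ k 4), ρb.toGaloisRep.IsIrreducible →
        ρb.IsSymplecticWithMultiplierFun (fun g => (((Units.map (ZMod.castHom (dvd_refl p)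
        k).toMonoidHom ((modularCyclotomicCharacter (AlgebraicClosure ℚ)
        (HasEnoughRootsOfUnity.natCard_rootsOfUnity (AlgebraicClosure ℚ) p)).comp
        (MulSemiringAction.toRingAut (Field.absoluteGaloisGroup ℚ) (AlgebraicClosure ℚ)) g))⁻¹ : kˣ)
        : k)) → (∀ v : HeightOneSpectrum (𝓞 ℚ), ((p : ℕ) : 𝓞 ℚ) ∈ v.asIdeal → ∃ g : GL (Fin 4) k,
        ∀ (τ : Field.absoluteGaloisGroup (v.adicCompletion ℚ)) (i j : Fin 4), j < i →
        (g * ρb.toLocal v τ * g⁻¹).val i j = 0) → ∀ (hcpt : isCompact_glFiniteIntegralLevel 4 ℚ) (ι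
        : PadicAlgCl p ≃+* ℂ), ∃ (π : CuspidalAutomorphicRepData 4 ℚ hcpt) (r : FramedGaloisRep ℚ
        (PadicAlgCl p) 4), π.1.IsRegularAlgebraic ∧
        (∀ v : HeightOneSpectrum (𝓞 ℚ), ((p : ℕ) : 𝓞 ℚ) ∈ v.asIdeal → π.1.IsUnramifiedAt v) ∧
        (∃ μ : Field.absoluteGaloisGroup ℚ → PadicAlgCl p, r.IsSymplecticWithMultiplierFun μ) ∧
        (∀ v : HeightOneSpectrum (𝓞 ℚ), ((p : ℕ) : 𝓞 ℚ) ∈ v.asIdeal → ∃ a : Fin 4 →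
        ℕ, Function.Injective a ∧ r.IsGreenbergOrdinaryOfShapeAt v a) ∧
        (∀ᶠ v : HeightOneSpectrum (𝓞 ℚ) in Filter.cofinite,
        ∃ α : Multiset ℂ, π.1.HasSatakeParamAt v α ∧ r.IsUnramifiedAt v ∧
        r.HasFrobCharpolyAt v (arithFrobPolyOfSatake ι v.residueCard 4 α)) ∧
        (∀ᶠ v : HeightOneSpectrum (𝓞 ℚ) in Filter.cofinite, r.IsUnramifiedAt v ∧
        ρb.IsUnramifiedAt v ∧ ∃ (P : Polynomial (Valued.integer (PadicAlgCl p))) (Pb : Polynomial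
        k), r.HasFrobCharpolyAt v (P.map (Valued.integer (PadicAlgCl p)).subtype) ∧
        ρb.HasFrobCharpolyAt v Pb ∧ P.map red = Pb)) →
    ∀ (A : AbelianVariety ℚ), A.dim = 2 → ∀ (ℓ : ℕ) [Fact ℓ.Prime] (b : Module.Basis (Fin 4) ℚ_[ℓ]
      (A.rationalTateModule ℓ)) (r : FramedGaloisRep ℚ (PadicAlgCl ℓ) 4),
      (∀ g : Field.absoluteGaloisGroup ℚ, (r g).val = ((LinearMap.toMatrix b b (A.rationalTateRep ℓ
      g⁻¹)).map (algebraMap ℚ_[ℓ] (PadicAlgCl ℓ))).transpose) → r.toGaloisRep.IsIrreducible →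
      ∀ (hcpt : isCompact_glFiniteIntegralLevel 4 ℚ) (ι : PadicAlgCl ℓ ≃+* ℂ),
      ∃ π : CuspidalAutomorphicRepData 4 ℚ hcpt, π.1.IsLAlgebraic ∧
      ∀ᶠ v : HeightOneSpectrum (𝓞 ℚ) in Filter.cofinite,
      ∃ a : Multiset ℂ, π.1.HasSatakeParamAt v a ∧ r.IsUnramifiedAt v ∧
      r.HasFrobCharpolyAt v (arithFrobPolyOfSatake ι v.residueCard 1 a)

-- `linter.deprecated` off for the next declaration only: its hypothesis must be the deprecated record.
set_option linter.deprecated false in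
/-- **BCGP 2025 Lemma 10.4.1 with Remark 10.4.2 and Theorem 10.2.1 — the CORRECTED typed implication
(similitude of the automorphic lift FIXED), proved from the deprecated `∃ μ` record.** The
CONCLUSION TYPE of this theorem is the corrected statement of this file (module docstring,
`## Review 2` CORRECTED BRACKET and `## Verdict clean-up`; name reserved for it as a fact:
`bcgp_serreRegularWeightFixedSimilitude_implies_allAbelianSurfacesModular`). IF, for all large `p`
(Remark 10.4.2 variant), every irreducible framed `ρ̄ : Γ_ℚ → GL₄(k)` (`k = k̄` of characteristic
`p`, any reduction map `red : 𝒪_{ℚ̄_p} → k`) that is symplectic with multiplier `ε̄⁻¹` and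
triangularisable on `Γ_{ℚ_p}` is congruent (cofinitely many integral Frobenius polynomials reducing
under `red` to those of `ρ̄`) to a framed `r : Γ_ℚ → GL₄(ℚ̄_p)` which is symplectic with multiplier
EXACTLY `ε_p^{-(1+2s)}` for some `s : ℕ` with `p - 1 ∣ s` (`ε_p = GaloisRep.cyclotomicCharacter ℚ p`
pushed along `ℤ_p → ℚ_p → ℚ̄_p`, the same expression as in
`bcgp_serreWreathFixedSimilitude_implies_quadraticImprimitiveSurfacesModular`; `s` is the
even-parity integral Tate shift putting the Hodge–Tate shape in `ℕ⁴`), Greenberg-ordinary of an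
injective shape at `p`, and attached by cofinite Satake–Frobenius matching
(`arithFrobPolyOfSatake ι q_v 4`) to a cuspidal REGULAR ALGEBRAIC `Π` on `GL₄(𝔸_ℚ)` unramified at
`p` — the residual-modularity HYPOTHESIS of Lemma 10.4.1 ("an ordinary cuspidal automorphic
representation `π` of `GSp₄/ℚ` of regular weight, level prime to `p`, and central character `|·|²`,
such that `ρ̄_{π,p} ≅ ρ̄`", p. 146) read through the `GL₄` proxy, first bracket —, THEN every abelian
surface `A/ℚ` whose framed dual `ℓ`-adic `H¹_ét(A_ℚ̄, ℚ̄_ℓ) = (V_ℓ A)^∨ ⊗ ℚ̄_ℓ` (`r(g) = [g⁻¹]_bᵀ`)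
is irreducible is modular in the sense of Def. 1.8.12 with one factor (an L-algebraic cuspidal `π`
on `GL₄(𝔸_ℚ)` with cofinite Satake–Frobenius matching, `arithFrobPolyOfSatake ι q_v 1`; second
bracket) — VERBATIM the record except for that ONE clause. Why this is the faithful rendering: the
printed `π` has central character `|·|²`, i.e. `ν ∘ ρ_{π,p} = ε⁻¹` exactly (§1.8.9; Prop. 7.5.7),
and (a) it yields such a witness — `r := ρ_{π,p} ⊗ ε^{-s}` for any `s ∈ (p-1)ℕ` with
`s ≥ (k+l)/2 - 2` for the regular weight `(k, l; 2)` (reduction unchanged as `ε̄^{p-1} = 1`,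
multiplier exactly `ε^{-(1+2s)}`, Hodge–Tate shape `((k+l)/2 - 1 + s, s - (k-l)/2, s + (k-l)/2 + 1,
s + 2 - (k+l)/2) ∈ ℕ⁴` injective because the weight is regular, Greenberg-ordinary by the last
bullet of the theorem of §1.8.9), `Π :=` the transfer of `π` to `GL₄` (§1.8.10) twisted by the
matching power of `|det|` —, while (b) such a witness gives the printed `π` back by published
results only: `r ⊗ ε^{s}` has multiplier exactly `ε⁻¹`, reduction `ρ̄` (`p - 1 ∣ s`) and is still
crystalline ordinary at `p`; the correspondingly twisted `Π` is of symplectic type and descends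
[Arthur 2013, Thm 1.5.2] [Gee–Taïbi 2019, §2] to a cuspidal `π` of general type with central
character `|·|²`, level prime to `p` (`Π` unramified at `p`), regular weight, ordinary at `p` by
crystalline local–global compatibility. So the conclusion type = [Lemma 10.4.1 in the Remark
10.4.2 variant, proof p. 146: Prop. 7.5.7, Thm. 7.5.8 for types **A** and **B**[C₂], Thm. 10.2.1 for
the 32 other Galois types] ∘ [that descent package], restricted in its conclusion to irreducible
`H¹` (Def. 1.8.12 with `n₁ = 4`); it is PROVED in the source — conditionally, like every result of
the source, on the twisted weighted fundamental lemma (op. cit. §1.6, `## Status`) — and its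
hypothesis (first bracket) is NOT asserted anywhere. THIS theorem only certifies, by pure logic, that
the corrected statement claims no more than the record it corrects (a stronger hypothesis gives a
weaker implication: a fixed-similitude witness is an `∃ μ` witness); `linter.deprecated` is off for
it because it must name the deprecated record as its hypothesis. The `…Proofs` companion, Part 4,
shows the conclusion type equivalent to the pinned form (`serreToAbelianSurfacesFixedSimilitude_iff_pinned`)
and equal to "corrected wreath fact ⊕ primitive slice"
(`bcgp_serreRegularWeightFixedSimilitude_of_wreathFixedSimilitude_of_primitive`).
[cite: BoxerCalegariGeePilloni2025, Lemma 10.4.1 with Rem. 10.4.2 (statement and proof, p. 146: central character |·|², level prime to p, regular weight); §1.8.9 (standing convention "central character |·|²"; ν ∘ ρ_{π,p} = ε⁻¹, Hodge–Tate weights and ordinary shape of weight (k, l; 2)); Prop. 7.5.7 and Thm. 7.5.8 (pp. 118–120); Thm 10.2.1 (pp. 138–139); §1.8.10; Def. 1.8.12]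
[cite: Arthur2013, Thm 1.5.2 (descent GL₄ → GSp₄ used to read the GL₄ proxy)]
[cite: GeeTaibi2019, §2 (Arthur's classification for GSp₄)] -/
theorem bcgp_serreRegularWeightFixedSimilitude_implies_allAbelianSurfacesModular_of_serreRegularWeight
    (h : bcgp_serreRegularWeight_implies_allAbelianSurfacesModular) :
    (∃ P₀ : ℕ, ∀ (p : ℕ) [Fact p.Prime], P₀ ≤ p → ∀ (k : Type) [Field k] [CharP k p] [IsAlgClosed k]
        [TopologicalSpace k] [DiscreteTopology k] (red : Valued.integer (PadicAlgCl p) →+* k) (ρb :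
        FramedGaloisRep ℚ k 4), ρb.toGaloisRep.IsIrreducible →
        ρb.IsSymplecticWithMultiplierFun (fun g => (((Units.map (ZMod.castHom (dvd_refl p)
        k).toMonoidHom ((modularCyclotomicCharacter (AlgebraicClosure ℚ)
        (HasEnoughRootsOfUnity.natCard_rootsOfUnity (AlgebraicClosure ℚ) p)).comp
        (MulSemiringAction.toRingAut (Field.absoluteGaloisGroup ℚ) (AlgebraicClosure ℚ)) g))⁻¹ : kˣ)
        : k)) → (∀ v : HeightOneSpectrum (𝓞 ℚ), ((p : ℕ) : 𝓞 ℚ) ∈ v.asIdeal → ∃ g : GL (Fin 4) k,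
        ∀ (τ : Field.absoluteGaloisGroup (v.adicCompletion ℚ)) (i j : Fin 4), j < i →
        (g * ρb.toLocal v τ * g⁻¹).val i j = 0) → ∀ (hcpt : isCompact_glFiniteIntegralLevel 4 ℚ) (ι
        : PadicAlgCl p ≃+* ℂ), ∃ (π : CuspidalAutomorphicRepData 4 ℚ hcpt) (r : FramedGaloisRep ℚ
        (PadicAlgCl p) 4), π.1.IsRegularAlgebraic ∧
        (∀ v : HeightOneSpectrum (𝓞 ℚ), ((p : ℕ) : 𝓞 ℚ) ∈ v.asIdeal → π.1.IsUnramifiedAt v) ∧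
        (∃ s : ℕ, (p - 1) ∣ s ∧ r.IsSymplecticWithMultiplierFun (fun g => algebraMap ℚ_[p]
          (PadicAlgCl p) (((((GaloisRep.cyclotomicCharacter ℚ p g)⁻¹ : ℤ_[p]ˣ) : ℤ_[p]) : ℚ_[p]) ^
          (1 + 2 * s)))) ∧
        (∀ v : HeightOneSpectrum (𝓞 ℚ), ((p : ℕ) : 𝓞 ℚ) ∈ v.asIdeal → ∃ a : Fin 4 →
        ℕ, Function.Injective a ∧ r.IsGreenbergOrdinaryOfShapeAt v a) ∧
        (∀ᶠ v : HeightOneSpectrum (𝓞 ℚ) in Filter.cofinite,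
        ∃ α : Multiset ℂ, π.1.HasSatakeParamAt v α ∧ r.IsUnramifiedAt v ∧
        r.HasFrobCharpolyAt v (arithFrobPolyOfSatake ι v.residueCard 4 α)) ∧
        (∀ᶠ v : HeightOneSpectrum (𝓞 ℚ) in Filter.cofinite, r.IsUnramifiedAt v ∧
        ρb.IsUnramifiedAt v ∧ ∃ (P : Polynomial (Valued.integer (PadicAlgCl p))) (Pb : Polynomial
        k), r.HasFrobCharpolyAt v (P.map (Valued.integer (PadicAlgCl p)).subtype) ∧
        ρb.HasFrobCharpolyAt v Pb ∧ P.map red = Pb)) →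
    ∀ (A : AbelianVariety ℚ), A.dim = 2 → ∀ (ℓ : ℕ) [Fact ℓ.Prime] (b : Module.Basis (Fin 4) ℚ_[ℓ]
      (A.rationalTateModule ℓ)) (r : FramedGaloisRep ℚ (PadicAlgCl ℓ) 4),
      (∀ g : Field.absoluteGaloisGroup ℚ, (r g).val = ((LinearMap.toMatrix b b (A.rationalTateRep ℓ
      g⁻¹)).map (algebraMap ℚ_[ℓ] (PadicAlgCl ℓ))).transpose) → r.toGaloisRep.IsIrreducible →
      ∀ (hcpt : isCompact_glFiniteIntegralLevel 4 ℚ) (ι : PadicAlgCl ℓ ≃+* ℂ),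
      ∃ π : CuspidalAutomorphicRepData 4 ℚ hcpt, π.1.IsLAlgebraic ∧
      ∀ᶠ v : HeightOneSpectrum (𝓞 ℚ) in Filter.cofinite,
      ∃ a : Multiset ℂ, π.1.HasSatakeParamAt v a ∧ r.IsUnramifiedAt v ∧
      r.HasFrobCharpolyAt v (arithFrobPolyOfSatake ι v.residueCard 1 a) := by
  rintro ⟨P₀, hP⟩
  apply h
  refine ⟨P₀, ?_⟩
  intro p _ hp k _ _ _ _ _ red ρb hirr hsymp htri hcpt ι
  obtain ⟨π, r, h1, h2, ⟨s, -, hs⟩, h4, h5, h6⟩ := hP p hp k red ρb hirr hsymp htri hcpt ι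
  exact ⟨π, r, h1, h2, ⟨_, hs⟩, h4, h5, h6⟩

end Literature.NumberTheory.DiophantineGeometry
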